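import Summits.CriticalPhenomena.PercolationContinuityZ3.Theorems.PercNearOneGluingNoHeavyQuantFarTwoAnchorLaw
import HarnessLib

/-!
# QUANT lane R8, front "FAR beyond trees", layer one — TWO-ANCHOR BLOCKS III: the decoupled weights and the TWO-ANCHOR TRANSFER theorem

builds on p205010 (kernel theorem, internal audit signed; external expert review pending)

Support file (`--supports stmt-CriticalPhenomena-4575`), seat `prim-quant-p1` (gen 19); memo
`run/shared/lean/prim/quant/prim-quant-p1-g19/FOR-LEAD-CACTI.md` §3 (kernel plan §5, file K5c).  Standard axioms; no sorries; definitions `Block.stem`, `Block.decouple`.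

Setting `Block.IsTwoAnchor c v₁ v₂ Z L par` (a block `Z` pendant at `c`, leaves `L` pendant at the anchors `v₁, v₂`, an arbitrary core), weights
`w` vanishing between `Z` and `(Z ∪ {c})ᶜ` and on the non-parent pairs at the leaves, block relays `A ∩ Z ⊆ L` with both anchors loaded.
The DECOUPLED weights `Block.decouple … w` keep `w` off the block and on the hairs, join `c` to `vᵢ` by a single pair of weight
`mᵢ = P_w(c ↔ vᵢ in core)` and kill every other pair of the block: under them the block is two independent bundles at `c` (a pendant tree)
with the same tip marginals.

* `Block.stem`, `Block.decouple` (+ value lemmas); `Block.real_congr_of_vanish` (a.s. absence of weight-zero pairs);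
* `Block.real_coreReach_decouple`, `Block.real_coreReach_inter_decouple` — under the decoupled weights `P(E'ᵢ) = mᵢ`, `P(E'₁E'₂) = m₁m₂`;
* `Block.real_hair_decouple`, `Block.real_onReach_leaf` — the hair laws agree; internal marginal of a leaf `= P(c ↔ par ℓ in core)·w(s(par ℓ, ℓ))`.
The TWO-ANCHOR TRANSFER theorem itself (`Block.real_card_le_one_le_twoAnchor`: `P_{w'}(N ≤ 1) ≤ t ⟹ P_w(N ≤ 1) ≤ t`) is assembled from these,
`Block.twoAnchor_dominates` and `Block.real_card_le_one_le_of_dominates` in `…QuantFarTwoAnchorTransfer` (kernel plan K5d).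
[cite: Grimmett1999, §1.3 p. 10; §2.2] (product measure, Harris' inequality); the theorems [this work].
-/

noncomputable section

namespace Summit.CriticalPhenomena.PercolationContinuityZ3.Theorems

namespace Quant

namespace Block

open Finset MeasureTheory Set
open Literature.Probability.LatticeModels
open Literature.Probability.Percolation
open Bundle (offZ avoid)
open scoped Classical

variable {n : ℕ}

/-! ## Generic tools -/

/-- Events agreeing off the configurations containing a pair of a weight-zero finite set have the same probability. [this work] -/
theorem real_congr_of_vanish (v : Sym2 (Fin n) → unitInterval) (Bd : Finset (Sym2 (Fin n))) (hv : ∀ e ∈ Bd, (v e : ℝ) = 0)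
    (S T : Set (BondConfig (Fin n))) (hST : ∀ ω, (∀ e ∈ Bd, e ∉ ω) → (ω ∈ S ↔ ω ∈ T)) :
    (prodBernoulli v).real S = (prodBernoulli v).real T := by
  set μ := prodBernoulli v with hμ
  set Nbad : Set (BondConfig (Fin n)) := {ω | ∃ e ∈ Bd, e ∈ ω} with hN
  have hmeas : ∀ U : Set (BondConfig (Fin n)), MeasurableSet U := fun U => (Set.toFinite U).measurableSet
  have hN0 : μ.real Nbad = 0 := by
    have h0 : μ Nbad = 0 := prodBernoulli_setOf_exists_mem_eq_zero v Bd hv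
    simp [measureReal_def, h0]
  have hsplit : ∀ U : Set (BondConfig (Fin n)), μ.real U = μ.real (U \ Nbad) := by
    intro U
    have h := measureReal_inter_add_sdiff (μ := μ) (s := U) (hmeas Nbad)
    have h0 : μ.real (U ∩ Nbad) = 0 :=
      le_antisymm ((measureReal_mono Set.inter_subset_right).trans hN0.le) measureReal_nonneg
    linarith
  have hdiff : S \ Nbad = T \ Nbad := by
    ext ω
    simp only [Set.mem_sdiff, hN, mem_setOf_eq, not_exists, not_and]
    constructor
    · rintro ⟨hS, hω⟩; exact ⟨(hST ω hω).1 hS, hω⟩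
    · rintro ⟨hT, hω⟩; exact ⟨(hST ω hω).2 hT, hω⟩
  rw [hsplit S, hsplit T, hdiff]

/-- The event "the pair `e` is open" is determined by `{e}`. [folklore] -/
theorem determinedBy_mem (e : Sym2 (Fin n)) : DeterminedBy {ω : BondConfig (Fin n) | e ∈ ω} ({e} : Set (Sym2 (Fin n))) := by
  rw [determinedBy_iff]
  intro ω ω' h
  simp only [mem_setOf_eq]
  exact ⟨fun h1 => ((Set.ext_iff.1 h e).1 ⟨h1, rfl⟩).1, fun h1 => ((Set.ext_iff.1 h e).2 ⟨h1, rfl⟩).1⟩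

/-- Core reachability is an increasing event. [folklore] -/
theorem isUpperSet_coreReach (c v : Fin n) (Z L : Finset (Fin n)) :
    IsUpperSet {ω : BondConfig (Fin n) | core Z L ω ∈ openConn c v} := by
  intro ω ω' hle h
  have hsub : core Z L ω ⊆ core Z L ω' := fun e he => ⟨hle he.1, he.2⟩
  exact (h : (openGraph (core Z L ω)).Reachable c v).mono (SimpleGraph.fromEdgeSet_mono hsub)

/-! ## The decoupled weights -/

/-- The stem weight `mᵥ = P_w(c ↔ v in the core)` as a point of `[0,1]`. [this work] -/
def stem (c v : Fin n) (Z L : Finset (Fin n)) (w : Sym2 (Fin n) → unitInterval) : unitInterval :=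
  ⟨(prodBernoulli w).real {ω | core Z L ω ∈ openConn c v}, measureReal_nonneg, measureReal_le_one⟩

/-- The DECOUPLED weights: `w` off the block and on the hairs `s(par ℓ, ℓ)`, stems `s(c, vᵢ)` of weight `mᵢ`, all other block pairs `0`.
[this work] -/
def decouple (c v₁ v₂ : Fin n) (Z L : Finset (Fin n)) (par : Fin n → Fin n) (w : Sym2 (Fin n) → unitInterval) :
    Sym2 (Fin n) → unitInterval := fun e =>
  if e ∈ avoid Z then w e
  else if e = s(c, v₁) then stem c v₁ Z L w
  else if e = s(c, v₂) then stem c v₂ Z L w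
  else if ∃ ℓ ∈ L, e = s(par ℓ, ℓ) then w e else 0

section TwoAnchor

variable {o c v₁ v₂ : Fin n} {Z L : Finset (Fin n)} {par : Fin n → Fin n} (H : IsTwoAnchor c v₁ v₂ Z L par)
  (w : Sym2 (Fin n) → unitInterval)
include H

omit H in
/-- A pair with an end in `Z` does not avoid `Z`. [this work] -/
theorem not_avoid_of_mem {x y : Fin n} (hx : x ∈ Z) : s(x, y) ∉ avoid Z := by
  intro h
  exact (Finset.mem_filter.1 h).2 x hx (Sym2.mem_mk_left x y)

/-- The stem pairs differ. [this work] -/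
theorem stem_ne : s(c, v₁) ≠ s(c, v₂) := by
  intro h
  rcases Sym2.eq_iff.1 h with ⟨-, h2⟩ | ⟨h1, -⟩
  · exact H.hne h2
  · exact H.cZ (h1 ▸ H.v₂Z)

/-- A hair pair is not a stem pair. [this work] -/
theorem hair_ne_stem {ℓ : Fin n} (hℓ : ℓ ∈ L) (v : Fin n) : s(par ℓ, ℓ) ≠ s(c, v) := by
  intro h
  rcases Sym2.eq_iff.1 h with ⟨h1, -⟩ | ⟨-, h2⟩
  · exact H.cZ (h1 ▸ (par_mem H hℓ).1)
  · exact H.cZ (h2 ▸ H.LZ hℓ)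

omit H in
/-- `decouple` agrees with `w` off the block. [this work] -/
theorem decouple_of_avoid {e : Sym2 (Fin n)} (he : e ∈ avoid Z) : decouple c v₁ v₂ Z L par w e = w e := by
  simp only [decouple, if_pos he]

/-- `decouple` on the first stem. [this work] -/
theorem decouple_stem₁ : decouple c v₁ v₂ Z L par w s(c, v₁) = stem c v₁ Z L w := by
  have h1 : s(c, v₁) ∉ avoid Z := by rw [Sym2.eq_swap]; exact not_avoid_of_mem H.v₁Z
  simp only [decouple, if_neg h1, if_true]

/-- `decouple` on the second stem. [this work] -/
theorem decouple_stem₂ : decouple c v₁ v₂ Z L par w s(c, v₂) = stem c v₂ Z L w := by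
  have h1 : s(c, v₂) ∉ avoid Z := by rw [Sym2.eq_swap]; exact not_avoid_of_mem H.v₂Z
  simp only [decouple, if_neg h1, if_neg (stem_ne H).symm, if_true]

/-- `decouple` keeps the hair weights. [this work] -/
theorem decouple_hair {ℓ : Fin n} (hℓ : ℓ ∈ L) : decouple c v₁ v₂ Z L par w s(par ℓ, ℓ) = w s(par ℓ, ℓ) := by
  have h1 : s(par ℓ, ℓ) ∉ avoid Z := not_avoid_of_mem (par_mem H hℓ).1
  have hex : ∃ ℓ' ∈ L, s(par ℓ, ℓ) = s(par ℓ', ℓ') := ⟨ℓ, hℓ, rfl⟩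
  simp only [decouple, if_neg h1, if_neg (hair_ne_stem H hℓ v₁), if_neg (hair_ne_stem H hℓ v₂), if_pos hex]

omit H in
/-- `decouple` vanishes on every other pair. [this work] -/
theorem decouple_zero {e : Sym2 (Fin n)} (h1 : e ∉ avoid Z) (h2 : e ≠ s(c, v₁)) (h3 : e ≠ s(c, v₂)) (h4 : ¬ ∃ ℓ ∈ L, e = s(par ℓ, ℓ)) :
    (decouple c v₁ v₂ Z L par w e : ℝ) = 0 := by
  simp only [decouple, if_neg h1, if_neg h2, if_neg h3, if_neg h4]; rfl

/-- The decoupled weights also hang the block at `c`. [this work] -/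
theorem decouple_block_vanish :
    ∀ x y : Fin n, x ≠ y → x ∈ Z → y ∉ Z → y ≠ c → (decouple c v₁ v₂ Z L par w s(x, y) : ℝ) = 0 := by
  intro x y _ hx hy hyc
  refine decouple_zero w (not_avoid_of_mem hx) ?_ ?_ ?_
  · intro h
    rcases Sym2.eq_iff.1 h with ⟨h1, -⟩ | ⟨-, h2⟩
    · exact H.cZ (h1 ▸ hx)
    · exact hyc h2
  · intro h
    rcases Sym2.eq_iff.1 h with ⟨h1, -⟩ | ⟨-, h2⟩
    · exact H.cZ (h1 ▸ hx)
    · exact hyc h2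
  · rintro ⟨ℓ, hℓ, h⟩
    rcases Sym2.eq_iff.1 h with ⟨-, h2⟩ | ⟨-, h2⟩
    · exact hy (h2 ▸ H.LZ hℓ)
    · exact hy (h2 ▸ (par_mem H hℓ).1)

/-- The decoupled weights also make the leaves pendant at their parents. [this work] -/
theorem decouple_leaf_vanish :
    ∀ ℓ ∈ L, ∀ x : Fin n, x ≠ ℓ → x ≠ par ℓ → (decouple c v₁ v₂ Z L par w s(ℓ, x) : ℝ) = 0 := by
  intro ℓ hℓ x hxℓ hxp
  refine decouple_zero w (not_avoid_of_mem (H.LZ hℓ)) ?_ ?_ ?_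
  · intro h
    rcases Sym2.eq_iff.1 h with ⟨h1, -⟩ | ⟨h1, -⟩
    · exact H.cZ (h1 ▸ H.LZ hℓ)
    · exact H.v₁L (h1 ▸ hℓ)
  · intro h
    rcases Sym2.eq_iff.1 h with ⟨h1, -⟩ | ⟨h1, -⟩
    · exact H.cZ (h1 ▸ H.LZ hℓ)
    · exact H.v₂L (h1 ▸ hℓ)
  · rintro ⟨ℓ', hℓ', h⟩
    rcases Sym2.eq_iff.1 h with ⟨h1, -⟩ | ⟨h1, h2⟩
    · exact (par_mem H hℓ').2 (h1 ▸ hℓ)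
    · exact hxp (by rw [h2, ← h1])

/-! ## The internal law under the decoupled weights -/

omit H in
/-- The block pairs other than stems and hairs that meet `Z` and avoid `L`: they carry decoupled weight `0`. [this work] -/
theorem decouple_core_vanish :
    ∀ e ∈ (corePairs Z L).filter (fun e => e ≠ s(c, v₁) ∧ e ≠ s(c, v₂)), (decouple c v₁ v₂ Z L par w e : ℝ) = 0 := by
  intro e he
  obtain ⟨hc, h2, h3⟩ := Finset.mem_filter.1 he
  obtain ⟨⟨z, hz, hze⟩, hL⟩ := (Finset.mem_filter.1 hc).2
  refine decouple_zero w (fun h => (Finset.mem_filter.1 h).2 z hz hze) h2 h3 ?_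
  rintro ⟨ℓ, hℓ, rfl⟩
  exact hL ℓ hℓ (Sym2.mem_mk_right _ _)

/-- Under the decoupled weights, almost surely `c ↔ vᵢ in the core` iff the stem `s(c, vᵢ)` is open (`i = 1`). [this work] -/
theorem coreReach_decouple_iff₁ {ω : BondConfig (Fin n)}
    (hω : ∀ e ∈ (corePairs Z L).filter (fun e => e ≠ s(c, v₁) ∧ e ≠ s(c, v₂)), e ∉ ω) :
    core Z L ω ∈ openConn c v₁ ↔ s(c, v₁) ∈ ω := by
  have hcv : c ≠ v₁ := fun h => H.cZ (h ▸ H.v₁Z)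
  constructor
  · intro h
    obtain ⟨p⟩ := (h : (openGraph (core Z L ω)).Reachable c v₁).symm
    cases p with
    | nil => exact absurd rfl hcv.symm
    | cons hadj p' =>
      rename_i x
      rw [openGraph_adj] at hadj
      obtain ⟨⟨heω, hz, hL⟩, hne⟩ := hadj
      -- the open core pair `s(v₁, x)` is a stem, hence `s(c, v₁)`
      have hmem : s(v₁, x) ∈ corePairs Z L := Finset.mem_filter.2 ⟨Finset.mem_univ _, hz, hL⟩
      by_contra hno
      have h1 : s(v₁, x) ≠ s(c, v₁) := by
        intro h; rw [h] at heω; exact hno heω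
      have h2 : s(v₁, x) ≠ s(c, v₂) := by
        intro h
        rcases Sym2.eq_iff.1 h with ⟨h3, -⟩ | ⟨h3, -⟩
        · exact hcv h3.symm
        · exact H.hne h3
      exact hω _ (Finset.mem_filter.2 ⟨hmem, h1, h2⟩) heω
  · intro h
    have hadj : (openGraph (core Z L ω)).Adj c v₁ := by
      rw [openGraph_adj]
      refine ⟨⟨h, ⟨v₁, H.v₁Z, Sym2.mem_mk_right _ _⟩, fun ℓ hℓ hmem => ?_⟩, hcv⟩
      rcases Sym2.mem_iff.1 hmem with rfl | rfl
      · exact H.cZ (H.LZ hℓ)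
      · exact H.v₁L hℓ
    exact hadj.reachable

/-- The mirror image of the block data (swap the anchors). [this work] -/
theorem symm : IsTwoAnchor c v₂ v₁ Z L par :=
  ⟨H.cZ, H.LZ, H.v₂Z, H.v₁Z, H.v₂L, H.v₁L, H.hne.symm, fun ℓ hℓ => (H.parv ℓ hℓ).symm⟩

omit H in
/-- Swapping the anchors does not change the decoupled weights. [this work] -/
theorem decouple_symm (H : IsTwoAnchor c v₁ v₂ Z L par) : decouple c v₂ v₁ Z L par w = decouple c v₁ v₂ Z L par w := by
  funext e
  by_cases h0 : e ∈ avoid Z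
  · simp only [decouple, if_pos h0]
  · by_cases h1 : e = s(c, v₁)
    · subst h1
      simp only [decouple, if_neg h0, if_true, if_neg (stem_ne H)]
    · by_cases h2 : e = s(c, v₂)
      · subst h2
        simp only [decouple, if_neg h0, if_true, if_neg (stem_ne H).symm]
      · simp only [decouple, if_neg h0, if_neg h1, if_neg h2]

/-- `P_{w'}(c ↔ v₁ in core) = m₁` under the decoupled weights `w'`. [this work] -/
theorem real_coreReach_decouple₁ :
    (prodBernoulli (decouple c v₁ v₂ Z L par w)).real {ω | core Z L ω ∈ openConn c v₁} =
      (prodBernoulli w).real {ω | core Z L ω ∈ openConn c v₁} := by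
  rw [real_congr_of_vanish _ _ (decouple_core_vanish w) _ {ω | s(c, v₁) ∈ ω}
    (fun ω hω => by simp only [mem_setOf_eq]; exact coreReach_decouple_iff₁ H hω),
    prodBernoulli_real_setOf_mem, decouple_stem₁ H w]
  rfl

/-- `P_{w'}(c ↔ v₂ in core) = m₂`. [this work] -/
theorem real_coreReach_decouple₂ :
    (prodBernoulli (decouple c v₁ v₂ Z L par w)).real {ω | core Z L ω ∈ openConn c v₂} =
      (prodBernoulli w).real {ω | core Z L ω ∈ openConn c v₂} := by
  rw [← decouple_symm w H]
  exact real_coreReach_decouple₁ (symm H) w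

/-- `P_{w'}(c ↔ v₁ and c ↔ v₂ in core) = m₁ m₂`. [this work] -/
theorem real_coreReach_inter_decouple :
    (prodBernoulli (decouple c v₁ v₂ Z L par w)).real ({ω | core Z L ω ∈ openConn c v₁} ∩ {ω | core Z L ω ∈ openConn c v₂}) =
      (prodBernoulli w).real {ω | core Z L ω ∈ openConn c v₁} * (prodBernoulli w).real {ω | core Z L ω ∈ openConn c v₂} := by
  have hω2 : ∀ ω : BondConfig (Fin n), (∀ e ∈ (corePairs Z L).filter (fun e => e ≠ s(c, v₁) ∧ e ≠ s(c, v₂)), e ∉ ω) →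
      ∀ e ∈ (corePairs Z L).filter (fun e => e ≠ s(c, v₂) ∧ e ≠ s(c, v₁)), e ∉ ω := by
    intro ω hω e he
    obtain ⟨h1, h2, h3⟩ := Finset.mem_filter.1 he
    exact hω e (Finset.mem_filter.2 ⟨h1, h3, h2⟩)
  rw [real_congr_of_vanish _ _ (decouple_core_vanish w) _ {ω | ((({s(c, v₁), s(c, v₂)} : Finset _) : Set (Sym2 (Fin n))) ⊆ ω)}
    (fun ω hω => by
      simp only [Set.mem_inter_iff, mem_setOf_eq, Finset.coe_insert, Finset.coe_singleton, Set.insert_subset_iff,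
        Set.singleton_subset_iff]
      rw [coreReach_decouple_iff₁ H hω, coreReach_decouple_iff₁ (symm H) (hω2 ω hω)]),
    prodBernoulli_real_subset, Finset.prod_pair (stem_ne H), decouple_stem₁ H w, decouple_stem₂ H w]
  rfl

/-- The hair laws are the same under `w` and the decoupled weights. [this work] -/
theorem real_hair_decouple (v : Fin n) {B : Finset (Fin n)} (hB : B ⊆ L) (hpar : ∀ ℓ ∈ B, par ℓ = v) (P : ℕ → Prop) :
    (prodBernoulli (decouple c v₁ v₂ Z L par w)).real {ω | P ((B.filter fun ℓ => s(v, ℓ) ∈ ω).card)} =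
      (prodBernoulli w).real {ω | P ((B.filter fun ℓ => s(v, ℓ) ∈ ω).card)} := by
  refine prodBernoulli_real_eq_of_determinedBy _ _ (fun e he => ?_) (determinedBy_hair v B P) (Set.toFinite _).measurableSet
  obtain ⟨ℓ, hℓ, rfl⟩ := Finset.mem_image.1 (Finset.mem_coe.1 he)
  rw [← hpar ℓ hℓ]
  exact decouple_hair H w (hB hℓ)

/-- Internal marginal of a leaf: `P_v(c ↔ ℓ on Z) = P_v(c ↔ par ℓ in core) · v(s(par ℓ, ℓ))`. [this work] -/
theorem real_onReach_leaf (v : Sym2 (Fin n) → unitInterval)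
    (hv : ∀ ℓ ∈ L, ∀ x : Fin n, x ≠ ℓ → x ≠ par ℓ → (v s(ℓ, x) : ℝ) = 0) {ℓ : Fin n} (hℓ : ℓ ∈ L) :
    (prodBernoulli v).real {ω | onZ Z ω ∈ openConn c ℓ} =
      (prodBernoulli v).real {ω | core Z L ω ∈ openConn c (par ℓ)} * (v s(par ℓ, ℓ) : ℝ) := by
  have hmeas : ∀ U : Set (BondConfig (Fin n)), MeasurableSet U := fun U => (Set.toFinite U).measurableSet
  rw [real_congr_of_goodL v hv _ ({ω | core Z L ω ∈ openConn c (par ℓ)} ∩ {ω | s(par ℓ, ℓ) ∈ ω})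
    (fun ω hω => by simp only [Set.mem_inter_iff, mem_setOf_eq]; exact on_reach_leaf_iff H hω hℓ)]
  have hsub : ({s(par ℓ, ℓ)} : Set (Sym2 (Fin n))) ⊆ (↑(corePairs Z L) : Set (Sym2 (Fin n)))ᶜ := by
    intro e he hc
    rw [Set.mem_singleton_iff] at he
    subst he
    exact (Finset.mem_filter.1 (Finset.mem_coe.1 hc)).2.2 ℓ hℓ (Sym2.mem_mk_right _ _)
  rw [prodBernoulli_real_inter_of_determinedBy v (corePairs Z L) (determinedBy_core Z L fun η => η ∈ openConn c (par ℓ))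
    ((determinedBy_mem _).mono hsub) (hmeas _) (hmeas _), prodBernoulli_real_setOf_mem]

end TwoAnchor

end Block

end Quant

end Summit.CriticalPhenomena.PercolationContinuityZ3.Theorems
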